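import Mathlib
import HarnessLib

/-!
# Socle versus cosocle under a Hecke-self-adjoint perfect pairing: `#(M/ℓM)[𝔪] = #(M/𝔪M)`

Pure commutative algebra (kernel-checked; axioms `propext`, `Classical.choice`, `Quot.sound`), isolated from its use for
modular Jacobians (`ModularJacobianMultiplicityOneCosocleProofs`): the step «`dim J₀(N)[𝔪] = dim (T_ℓ J₀(N)/𝔪)`» of
Darmon–Diamond–Taylor, *Fermat's Last Theorem*, Thm. 4.26 / pp. 133–134 (freeness of `T_ℓ(J₀(N))_𝔪` «follows by Nakayama»),
and of Tilouine 1997, Thm. 3.4, Cor. (1)–(3), in the form every freeness consumer needs.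

SETTING. `R` a commutative ring acting on a finitely generated free `ℤ`-module `M` (`H₁(X₀(N), ℤ)` with its Hecke action),
`B : M × M → ℤ` a PERFECT pairing (`x ↦ B(x, ·)` is a bijection `M → Hom(M, ℤ)`) for which `R` is SELF-ADJOINT
(`B(t x, y) = B(x, t y)`), a prime `ℓ`, an ideal `𝔪 ∋ ℓ` of `R`, and an `R`-linear `δ : M → P` («`x ↦ [ℓ⁻¹ x] ∈ J₀(N)(ℂ)`»)
whose kernel is exactly `ℓM` and whose image contains the `𝔪`-torsion `P[𝔪]` (for `J₀(N)`: `P[𝔪] ⊆ P[ℓ] = ℓ⁻¹Λ/Λ`).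

RESULTS. `exists_eq_nsmul_of_forall_dvd` (an element pairing into `ℓℤ` with everything is in `ℓM`);
`natCard_addMonoidHom_zmod_eq` (a finite abelian group killed by `ℓ` has as many `ℤ/ℓ`-valued characters as elements);
★ `natCard_torsionBySet_eq_natCard_quotient`: `#P[𝔪] = #(M/𝔪M)` — via the explicit isomorphisms
`P[𝔪] ≅ δ⁻¹(P[𝔪])/ℓM ≅ Hom(M/𝔪M, ℤ/ℓ)`, `x ↦ B(x, ·) mod ℓ`; ★ `finrank_torsionBySet_eq_finrank_quotient`: for `𝔪` maximal
with finite residue field `k`, `dim_k P[𝔪] = dim_k M/𝔪M`. Consequence (next file): multiplicity one `dim_k J₀(N)[𝔪] = 2`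
(Wiles / Buzzard, SOCLE form) gives `dim_k Λ/𝔪Λ = 2` (COSOCLE form), whence by Nakayama `Λ_𝔪` is generated by two
elements and — with the Eichler–Shimura rank count — free of rank `2` over `𝕋_𝔪`
(`Literature.Algebra.Module.FreenessCriterion`). No reflexivity/alternation of `B` is used (left-orthogonals only).

References: H. Darmon, F. Diamond, R. Taylor, Fermat's Last Theorem (CDM 1995) §4.5, Thm. 4.26 and pp. 133–134
[DarmonDiamondTaylor1995]; J. Tilouine, Hecke algebras and the Gorenstein property (1997), Thm. 3.4, Cor. (1)–(3)
[Tilouine1997Gorenstein]; B. Mazur, Modular curves and the Eisenstein ideal, Publ. IHÉS 47 (1977) §II.14–15 [Mazur1977].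
-/

set_option autoImplicit false

noncomputable section

open Module Function

namespace Literature.Algebra.Module

namespace SocleCosocle

/-! ### §1 Two counting lemmas -/

section Counting

variable {M : Type*} [AddCommGroup M]

/-- **Perfect pairings detect divisibility.** If `x ↦ B(x, ·)` is a bijection `M → Hom(M, ℤ)` and `B(x, y) ∈ ℓℤ` for every
`y`, then `x ∈ ℓM` (the injectivity half of «`T_ℓ(J)/ℓT_ℓ(J) ≅ J[ℓ]` is self-dual under the Weil/intersection pairing»).
[cite: DarmonDiamondTaylor1995, §4.5 (pp. 133–134); elementary algebra proved here] -/
theorem exists_eq_nsmul_of_forall_dvd (B : M →+ M →+ ℤ) (hB : Bijective B) {ℓ : ℕ} {x : M}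
    (hx : ∀ y, (ℓ : ℤ) ∣ B x y) : ∃ z : M, x = ℓ • z := by
  -- the functional `y ↦ B(x, y)/ℓ`
  let g : M →+ ℤ :=
    { toFun := fun y ↦ B x y / ℓ
      map_zero' := by simp
      map_add' := fun y y' ↦ by rw [map_add, Int.add_ediv_of_dvd_left (hx y)] }
  obtain ⟨z, hz⟩ := hB.2 g
  refine ⟨z, hB.1 ?_⟩
  rw [map_nsmul, hz]
  ext y
  change B x y = (ℓ • g) y
  rw [AddMonoidHom.nsmul_apply, nsmul_eq_mul]
  exact (Int.mul_ediv_cancel' (hx y)).symm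

/-- **A finite-dimensional `𝔽_ℓ`-vector space has exactly as many `ℤ/ℓ`-valued characters as elements** (it is
isomorphic to its dual; every additive map between `𝔽_ℓ`-vector spaces is linear).
[cite: Lang2002, Ch. XIII §6 (dual space of a finite-dimensional space; proved here)] -/
theorem natCard_addMonoidHom_zmod_eq (X : Type*) [AddCommGroup X] (ℓ : ℕ) [Fact ℓ.Prime] [Module (ZMod ℓ) X]
    [Module.Finite (ZMod ℓ) X] : Nat.card (X →+ ZMod ℓ) = Nat.card X := by
  classical
  let e' : (X →+ ZMod ℓ) ≃ Module.Dual (ZMod ℓ) X :=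
    { toFun := fun f ↦ f.toZModLinearMap ℓ
      invFun := fun g ↦ g.toAddMonoidHom
      left_inv := fun f ↦ by ext; rfl
      right_inv := fun g ↦ by ext; rfl }
  have h1 : Nat.card (Module.Dual (ZMod ℓ) X) = Nat.card (ZMod ℓ) ^ finrank (ZMod ℓ) (Module.Dual (ZMod ℓ) X) :=
    Module.natCard_eq_pow_finrank
  have h2 : Nat.card X = Nat.card (ZMod ℓ) ^ finrank (ZMod ℓ) X := Module.natCard_eq_pow_finrank
  have h3 : finrank (ZMod ℓ) (Module.Dual (ZMod ℓ) X) = finrank (ZMod ℓ) X := Subspace.dual_finrank_eq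
  rw [Nat.card_congr e', h1, h3, ← h2]

end Counting

/-! ### §2 The socle/cosocle count -/

section Main

variable {R M P : Type*} [CommRing R] [AddCommGroup M] [Module R M] [AddCommGroup P] [Module R P]

/-- Elements of `𝔪M` pair into `ℓℤ` with every `x` whose `𝔪`-multiples lie in `ℓM` (self-adjointness).
[cite: DarmonDiamondTaylor1995, §4.5 (pp. 133–134); algebra proved here] -/
theorem dvd_apply_of_mem_smul_top (B : M →+ M →+ ℤ) (hadj : ∀ (t : R) (x y : M), B (t • x) y = B x (t • y))
    {ℓ : ℕ} (𝔪 : Ideal R) {x : M} (hx : ∀ t ∈ 𝔪, ∃ z : M, t • x = ℓ • z) {y : M}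
    (hy : y ∈ 𝔪 • (⊤ : Submodule R M)) : (ℓ : ℤ) ∣ B x y := by
  refine Submodule.smul_induction_on hy (fun t ht n _ ↦ ?_) (fun a b ha hb ↦ ?_)
  · obtain ⟨z, hz⟩ := hx t ht
    rw [← hadj, hz, map_nsmul, AddMonoidHom.nsmul_apply, nsmul_eq_mul]
    exact dvd_mul_right _ _
  · rw [map_add]
    exact dvd_add ha hb

/-- **Socle = cosocle in cardinality.** Let `R` act on the finitely generated free `ℤ`-module `M`, let
`B : M × M → ℤ` be a perfect pairing for which `R` is self-adjoint, `ℓ` a prime, `𝔪 ∋ ℓ` an ideal, and `δ : M → P`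
an `R`-linear map with kernel exactly `ℓM` whose image contains `P[𝔪]`. Then `#P[𝔪] = #(M/𝔪M)`; explicitly
`P[𝔪] ≅ δ⁻¹(P[𝔪])/ℓM ≅ Hom(M/𝔪M, ℤ/ℓ)` by `x ↦ B(x, ·) mod ℓ`. (For `M = H₁(X₀(N), ℤ)`, `P = J₀(N)(ℂ)`,
`δ x = [ℓ⁻¹x]`: `dim J₀(N)[𝔪] = dim Λ/𝔪Λ`, Darmon–Diamond–Taylor p. 134.)
[cite: DarmonDiamondTaylor1995, §4.5 Thm. 4.26 and pp. 133–134; algebra proved here]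
[cite: Tilouine1997Gorenstein, Thm. 3.4, Cor. (1)–(3)] -/
theorem natCard_torsionBySet_eq_natCard_quotient [Module.Finite ℤ M] [Module.Free ℤ M]
    (B : M →+ M →+ ℤ) (hB : Bijective B) (hadj : ∀ (t : R) (x y : M), B (t • x) y = B x (t • y))
    (ℓ : ℕ) [Fact ℓ.Prime] (𝔪 : Ideal R) (hℓ : (ℓ : R) ∈ 𝔪) (δ : M →ₗ[R] P)
    (hker : ∀ x : M, δ x = 0 ↔ ∃ z : M, x = ℓ • z)
    (hrange : ∀ p ∈ Submodule.torsionBySet R P 𝔪, ∃ x : M, δ x = p) :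
    Nat.card (Submodule.torsionBySet R P 𝔪) = Nat.card (M ⧸ 𝔪 • (⊤ : Submodule R M)) := by
  classical
  have hℓ0 : ℓ ≠ 0 := (Fact.out : ℓ.Prime).ne_zero
  set N : Submodule R M := 𝔪 • (⊤ : Submodule R M) with hN
  -- (0) the quotient `X = M/𝔪M` is a finite abelian group killed by `ℓ`
  have hXℓ : ∀ x : M ⧸ N, ℓ • x = 0 := by
    intro x
    obtain ⟨y, rfl⟩ := N.mkQ_surjective x
    rw [← map_nsmul, Submodule.mkQ_apply, Submodule.Quotient.mk_eq_zero, ← Nat.cast_smul_eq_nsmul R]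
    exact Submodule.smul_mem_smul hℓ Submodule.mem_top
  haveI : Module.Finite ℤ (M ⧸ N) :=
    Module.Finite.of_surjective (N.mkQ.toAddMonoidHom.toIntLinearMap) N.mkQ_surjective
  haveI : Finite (M ⧸ N) := by
    refine Module.finite_of_fg_torsion (M ⧸ N) fun x ↦ ?_
    refine ⟨⟨(ℓ : ℤ), mem_nonZeroDivisors_of_ne_zero (by exact_mod_cast hℓ0)⟩, ?_⟩
    change (ℓ : ℤ) • x = 0
    rw [natCast_zsmul]
    exact hXℓ x
  -- (1) the subgroup `S = δ⁻¹(P[𝔪]) = {x | 𝔪 x ⊆ ℓM}`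
  let S : Submodule R M := (Submodule.torsionBySet R P 𝔪).comap δ
  have hS : ∀ x : M, x ∈ S ↔ ∀ t ∈ 𝔪, ∃ z : M, t • x = ℓ • z := by
    intro x
    rw [Submodule.mem_comap, Submodule.mem_torsionBySet_iff]
    constructor
    · intro h t ht
      exact (hker (t • x)).mp (by rw [map_smul]; exact h ⟨t, ht⟩)
    · rintro h ⟨t, ht⟩
      rw [← map_smul]
      exact (hker (t • x)).mpr (h t ht)
  -- (2) the character map `Φ : S → Hom(M/𝔪M, ℤ/ℓ)`, `x ↦ B(x, ·) mod ℓ`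
  let χ : S → (M →+ ZMod ℓ) := fun x ↦ (Int.castAddHom (ZMod ℓ)).comp (B (x : M))
  have hχN : ∀ (x : S), ∀ y ∈ N, χ x y = 0 := by
    intro x y hy
    change ((B (x : M) y : ℤ) : ZMod ℓ) = 0
    rw [ZMod.intCast_zmod_eq_zero_iff_dvd]
    exact dvd_apply_of_mem_smul_top B hadj 𝔪 ((hS x).mp x.2) hy
  let Φ₀ : S → (M ⧸ N →+ ZMod ℓ) := fun x ↦
    QuotientAddGroup.lift N.toAddSubgroup (χ x) fun y hy ↦ hχN x y hy
  have hΦ₀ : ∀ (x : S) (y : M), Φ₀ x (N.mkQ y) = ((B (x : M) y : ℤ) : ZMod ℓ) := fun x y ↦ rfl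
  let Φ : S →+ (M ⧸ N →+ ZMod ℓ) :=
    { toFun := Φ₀
      map_zero' := by
        ext y
        obtain ⟨y, rfl⟩ := N.mkQ_surjective y
        rw [hΦ₀]
        simp
      map_add' := fun x x' ↦ by
        ext y
        obtain ⟨y, rfl⟩ := N.mkQ_surjective y
        rw [AddMonoidHom.add_apply, hΦ₀, hΦ₀, hΦ₀, Submodule.coe_add, map_add, AddMonoidHom.add_apply,
          Int.cast_add] }
  -- (3) `ker Φ = {x ∈ S | x ∈ ℓM} = ker (δ|S)`
  let δS : S →+ Submodule.torsionBySet R P 𝔪 :=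
    { toFun := fun x ↦ ⟨δ x, x.2⟩
      map_zero' := by ext; simp
      map_add' := fun x x' ↦ by ext; simp }
  have hkers : Φ.ker = δS.ker := by
    ext x
    rw [AddMonoidHom.mem_ker, AddMonoidHom.mem_ker]
    constructor
    · intro h
      have h' : ∀ y, (ℓ : ℤ) ∣ B (x : M) y := fun y ↦ by
        rw [← ZMod.intCast_zmod_eq_zero_iff_dvd, ← hΦ₀]
        change Φ x (N.mkQ y) = 0
        rw [h]; rfl
      obtain ⟨z, hz⟩ := exists_eq_nsmul_of_forall_dvd B hB h'
      ext
      change δ x = 0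
      exact (hker x).mpr ⟨z, hz⟩
    · intro h
      have h0 : δ (x : M) = 0 := congrArg Subtype.val h
      obtain ⟨z, hz⟩ := (hker x).mp h0
      ext y
      obtain ⟨y, rfl⟩ := N.mkQ_surjective y
      change Φ₀ x (N.mkQ y) = 0
      rw [hΦ₀, hz, map_nsmul, AddMonoidHom.nsmul_apply, nsmul_eq_mul, Int.cast_mul, Int.cast_natCast,
        ZMod.natCast_self, zero_mul]
  -- (4) `Φ` is onto: lift a character through a `ℤ`-basis of `M`, invert `B`
  have hΦsurj : Surjective Φ := by
    intro g
    let b := Module.Free.chooseBasis ℤ M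
    let G : M →ₗ[ℤ] ℤ := b.constr ℤ fun i ↦ ((g (N.mkQ (b i))).val : ℤ)
    have hG : ∀ y : M, ((G y : ℤ) : ZMod ℓ) = g (N.mkQ y) := by
      intro y
      -- both sides are additive in `y`; compare on the basis
      let L₁ : M →+ ZMod ℓ := (Int.castAddHom (ZMod ℓ)).comp G.toAddMonoidHom
      let L₂ : M →+ ZMod ℓ := g.comp N.mkQ.toAddMonoidHom
      suffices h : L₁ = L₂ from DFunLike.congr_fun h y
      have : L₁.toIntLinearMap = L₂.toIntLinearMap := b.ext fun i ↦ by
        change ((G (b i) : ℤ) : ZMod ℓ) = g (N.mkQ (b i))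
        rw [Basis.constr_basis]
        simp
      exact AddMonoidHom.toIntLinearMap_injective this
    obtain ⟨x₀, hx₀⟩ := hB.2 G.toAddMonoidHom
    have hx₀' : ∀ y, B x₀ y = G y := fun y ↦ by rw [hx₀]; rfl
    have hx₀S : x₀ ∈ S := by
      rw [hS]
      intro t ht
      refine exists_eq_nsmul_of_forall_dvd B hB fun y ↦ ?_
      rw [hadj, hx₀', ← ZMod.intCast_zmod_eq_zero_iff_dvd, hG]
      have : N.mkQ (t • y) = 0 := by
        rw [Submodule.mkQ_apply, Submodule.Quotient.mk_eq_zero]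
        exact Submodule.smul_mem_smul ht Submodule.mem_top
      rw [this, map_zero]
    refine ⟨⟨x₀, hx₀S⟩, ?_⟩
    ext y
    obtain ⟨y, rfl⟩ := N.mkQ_surjective y
    change Φ₀ ⟨x₀, hx₀S⟩ (N.mkQ y) = g (N.mkQ y)
    rw [hΦ₀, ← hG, hx₀']
  -- (5) `δ|S` is onto `P[𝔪]`
  have hδSsurj : Surjective δS := by
    rintro ⟨p, hp⟩
    obtain ⟨x, hx⟩ := hrange p hp
    have hxS : x ∈ S := by
      change δ x ∈ Submodule.torsionBySet R P 𝔪
      rw [hx]; exact hp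
    exact ⟨⟨x, hxS⟩, Subtype.ext hx⟩
  -- (6) count
  have e₁ := QuotientAddGroup.quotientKerEquivOfSurjective δS hδSsurj
  have e₂ := QuotientAddGroup.quotientKerEquivOfSurjective Φ hΦsurj
  have e₃ : S ⧸ δS.ker ≃+ S ⧸ Φ.ker := QuotientAddGroup.quotientAddEquivOfEq hkers.symm
  letI inst1 : Module (ZMod ℓ) (M ⧸ N) := AddCommGroup.zmodModule hXℓ
  haveI inst2 : Module.Finite (ZMod ℓ) (M ⧸ N) := Module.Finite.of_finite
  have h4 : Nat.card (M ⧸ N →+ ZMod ℓ) = Nat.card (M ⧸ N) :=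
    @natCard_addMonoidHom_zmod_eq (M ⧸ N) _ ℓ _ inst1 inst2
  rw [← Nat.card_congr e₁.toEquiv, Nat.card_congr e₃.toEquiv, Nat.card_congr e₂.toEquiv, h4]

/-- **Socle = cosocle in dimension.** Under the hypotheses of `natCard_torsionBySet_eq_natCard_quotient`, if `𝔪` is
maximal with finite residue field `k = R/𝔪`, then `dim_k P[𝔪] = dim_k M/𝔪M` (both sides are finite `k`-vector spaces
of the same cardinality). [cite: DarmonDiamondTaylor1995, §4.5 Thm. 4.26 and pp. 133–134; algebra proved here] -/
theorem finrank_torsionBySet_eq_finrank_quotient [Module.Finite ℤ M] [Module.Free ℤ M]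
    (B : M →+ M →+ ℤ) (hB : Bijective B) (hadj : ∀ (t : R) (x y : M), B (t • x) y = B x (t • y))
    (ℓ : ℕ) [Fact ℓ.Prime] (𝔪 : Ideal R) [𝔪.IsMaximal] [Finite (R ⧸ 𝔪)] (hℓ : (ℓ : R) ∈ 𝔪) (δ : M →ₗ[R] P)
    (hker : ∀ x : M, δ x = 0 ↔ ∃ z : M, x = ℓ • z)
    (hrange : ∀ p ∈ Submodule.torsionBySet R P 𝔪, ∃ x : M, δ x = p)
    [Finite (Submodule.torsionBySet R P 𝔪)] :
    finrank (R ⧸ 𝔪) (Submodule.torsionBySet R P 𝔪) = finrank (R ⧸ 𝔪) (M ⧸ 𝔪 • (⊤ : Submodule R M)) := by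
  classical
  letI : Field (R ⧸ 𝔪) := Ideal.Quotient.field 𝔪
  have hcard := natCard_torsionBySet_eq_natCard_quotient B hB hadj ℓ 𝔪 hℓ δ hker hrange
  -- `M/𝔪M` is finite: it has the cardinality of the finite `P[𝔪]`
  haveI : Finite (M ⧸ 𝔪 • (⊤ : Submodule R M)) := by
    have hpos : 0 < Nat.card (M ⧸ 𝔪 • (⊤ : Submodule R M)) := by
      rw [← hcard]; exact Nat.card_pos
    exact (Nat.card_pos_iff.mp hpos).2
  haveI : Module.Finite (R ⧸ 𝔪) (Submodule.torsionBySet R P 𝔪) := Module.Finite.of_finite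
  haveI : Module.Finite (R ⧸ 𝔪) (M ⧸ 𝔪 • (⊤ : Submodule R M)) := Module.Finite.of_finite
  have h1 := Module.natCard_eq_pow_finrank (K := R ⧸ 𝔪) (V := Submodule.torsionBySet R P 𝔪)
  have h2 := Module.natCard_eq_pow_finrank (K := R ⧸ 𝔪) (V := M ⧸ 𝔪 • (⊤ : Submodule R M))
  have hk : 2 ≤ Nat.card (R ⧸ 𝔪) := by
    have := Finite.one_lt_card (α := R ⧸ 𝔪)
    omega
  exact Nat.pow_right_injective hk
    (show Nat.card (R ⧸ 𝔪) ^ _ = Nat.card (R ⧸ 𝔪) ^ _ by rw [← h1, ← h2, hcard])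

end Main

/-! ### §3 A perfect pairing on a finite free `ℤ`-module is perfect on both sides -/

section Flip

variable {M : Type*} [AddCommGroup M]

/-- **Left-perfect ⇒ right-perfect.** If `M` is a finitely generated free `ℤ`-module and `x ↦ B(x, ·)` is a bijection
`M → Hom(M, ℤ)`, then so is `y ↦ B(·, y)` (`M` is reflexive: `y ↦ B(·, y)` is evaluation `M ≅ M^∨∨` followed by the transpose
of the isomorphism `B : M ≅ M^∨`). [cite: Lang2002, Ch. XIII §6 (duality for finite free modules); proved here] -/
theorem flip_bijective [Module.Finite ℤ M] [Module.Free ℤ M] (B : M →+ M →+ ℤ) (hB : Bijective B) :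
    Bijective B.flip := by
  -- `B` as a `ℤ`-linear isomorphism `M ≃ M^∨`
  let L : (M →+ ℤ) ≃ₗ[ℤ] (M →ₗ[ℤ] ℤ) := addMonoidHomLequivInt ℤ
  let B' : M →ₗ[ℤ] Module.Dual ℤ M := L.toLinearMap ∘ₗ B.toIntLinearMap
  have hB' : Bijective B' := L.bijective.comp hB
  let eB : M ≃ₗ[ℤ] Module.Dual ℤ M := LinearEquiv.ofBijective B' hB'
  -- `B.flip = L⁻¹ ∘ eB^∨ ∘ eval`
  let Ψ : M → (M →+ ℤ) := fun y ↦ L.symm (eB.dualMap (Module.evalEquiv ℤ M y))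
  have hΨ : Bijective Ψ :=
    L.symm.bijective.comp (eB.dualMap.bijective.comp (Module.evalEquiv ℤ M).bijective)
  have hflip : (B.flip : M → (M →+ ℤ)) = Ψ := by
    funext y
    ext x
    rfl
  rw [hflip]
  exact hΨ

/-- **Right divisibility.** If `M` is finitely generated free over `ℤ`, `x ↦ B(x, ·)` is bijective and `B(x, y) ∈ ℓℤ` for every
`x`, then `y ∈ ℓM`. [cite: DarmonDiamondTaylor1995, §4.5 (pp. 133–134); elementary algebra proved here] -/
theorem exists_eq_nsmul_of_forall_dvd_right [Module.Finite ℤ M] [Module.Free ℤ M] (B : M →+ M →+ ℤ) (hB : Bijective B)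
    {ℓ : ℕ} {y : M} (hy : ∀ x, (ℓ : ℤ) ∣ B x y) : ∃ z : M, y = ℓ • z :=
  exists_eq_nsmul_of_forall_dvd B.flip (flip_bijective B hB) fun x ↦ by rw [AddMonoidHom.flip_apply]; exact hy x

end Flip

/-! ### §4 The reduced pairing on the `ℓ`-torsion: balanced and perfect on both sides -/

section TorsionPairing

variable {R M P : Type*} [CommRing R] [AddCommGroup M] [Module R M] [AddCommGroup P] [Module R P]

/-- **The mod-`ℓ` pairing on `P[ℓ] ≅ M/ℓM` is balanced and perfect** (Darmon–Diamond–Taylor, Lemma 1.38 reduced mod `ℓ`: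
«`T_ℓ(J)/ℓT_ℓ(J) ≅ J[ℓ] ≅ Hom(J[ℓ], 𝔽_ℓ)` as Hecke modules», §4.5 p. 134). Let `R` act on the finitely generated free `ℤ`-module
`M`, `B : M × M → ℤ` perfect (`x ↦ B(x,·)` bijective) and `R`-self-adjoint, `ℓ` prime, and `δ : M → P` `R`-linear with kernel
exactly `ℓM` and image containing the `ℓ`-torsion `P[ℓ]`. Then `P[ℓ]` carries a bi-additive `ℤ/ℓ`-valued pairing `B̄` with
`B̄(δx, δy) = B(x, y) mod ℓ`, which is `R`-BALANCED (`B̄(t p, q) = B̄(p, t q)`) and has trivial LEFT and RIGHT kernels.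
[cite: DarmonDiamondTaylor1995, §1.6 Lemma 1.38 (p. 41) and §4.5 (p. 134); algebra proved here] -/
theorem exists_balanced_perfect_pairing_torsionBy [Module.Finite ℤ M] [Module.Free ℤ M]
    (B : M →+ M →+ ℤ) (hB : Bijective B) (hadj : ∀ (t : R) (x y : M), B (t • x) y = B x (t • y))
    (ℓ : ℕ) [Fact ℓ.Prime] (δ : M →ₗ[R] P) (hker : ∀ x : M, δ x = 0 ↔ ∃ z : M, x = ℓ • z)
    (hrange : ∀ p ∈ Submodule.torsionBy R P ℓ, ∃ x : M, δ x = p) :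
    ∃ Bbar : Submodule.torsionBy R P ℓ →+ (Submodule.torsionBy R P ℓ →+ ZMod ℓ),
      (∀ (t : R) (p q : Submodule.torsionBy R P ℓ), Bbar (t • p) q = Bbar p (t • q)) ∧
      (∀ p : Submodule.torsionBy R P ℓ, (∀ q, Bbar p q = 0) → p = 0) ∧
      (∀ q : Submodule.torsionBy R P ℓ, (∀ p, Bbar p q = 0) → q = 0) := by
  classical
  set T : Submodule R P := Submodule.torsionBy R P ℓ with hT
  -- `δ` lands in the `ℓ`-torsion
  have hmem : ∀ x : M, δ x ∈ T := by
    intro x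
    rw [hT, Submodule.mem_torsionBy_iff, Nat.cast_smul_eq_nsmul, ← map_nsmul]
    exact (hker (ℓ • x)).mpr ⟨x, rfl⟩
  let δT : M →ₗ[R] T := LinearMap.codRestrict T δ hmem
  have hδT : ∀ x, (δT x : P) = δ x := fun x ↦ rfl
  have hδT_surj : Surjective δT := by
    rintro ⟨p, hp⟩
    obtain ⟨x, hx⟩ := hrange p hp
    exact ⟨x, Subtype.ext (by rw [hδT, hx])⟩
  have hδT_ker : ∀ x, δT x = 0 ↔ ∃ z : M, x = ℓ • z := fun x ↦ by
    rw [← hker x, ← hδT]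
    exact ⟨fun h ↦ by rw [h]; rfl, fun h ↦ Subtype.ext h⟩
  -- a section of `δT`; `B mod ℓ` only depends on `δT` of its arguments
  let s : T → M := Function.surjInv hδT_surj
  have hs : ∀ p, δT (s p) = p := Function.surjInv_eq hδT_surj
  have hwd : ∀ x x' : M, δT x = δT x' →
      (∀ y, ((B x y : ℤ) : ZMod ℓ) = ((B x' y : ℤ) : ZMod ℓ)) ∧ (∀ y, ((B y x : ℤ) : ZMod ℓ) = ((B y x' : ℤ) : ZMod ℓ)) := by
    intro x x' hxx'
    have h0 : δT (x - x') = 0 := by rw [map_sub, hxx', sub_self]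
    obtain ⟨z, hz⟩ := (hδT_ker (x - x')).mp h0
    constructor
    · intro y
      symm
      rw [ZMod.intCast_eq_intCast_iff_dvd_sub]
      refine ⟨B z y, ?_⟩
      rw [← AddMonoidHom.sub_apply, ← map_sub B x x', hz, map_nsmul, AddMonoidHom.nsmul_apply, nsmul_eq_mul]
    · intro y
      symm
      rw [ZMod.intCast_eq_intCast_iff_dvd_sub]
      refine ⟨B y z, ?_⟩
      rw [← map_sub (B y) x x', hz, map_nsmul, nsmul_eq_mul]
  -- the pairing
  let Brow : M → (T →+ ZMod ℓ) := fun x ↦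
    { toFun := fun q ↦ ((B x (s q) : ℤ) : ZMod ℓ)
      map_zero' := by
        rw [(hwd (s 0) 0 (by rw [hs, map_zero])).2 x, map_zero, Int.cast_zero]
      map_add' := fun q q' ↦ by
        rw [(hwd (s (q + q')) (s q + s q') (by rw [hs, map_add, hs, hs])).2 x, map_add, Int.cast_add] }
  have hBrow : ∀ x q, Brow x q = ((B x (s q) : ℤ) : ZMod ℓ) := fun x q ↦ rfl
  let Bbar : T →+ (T →+ ZMod ℓ) :=
    { toFun := fun p ↦ Brow (s p)
      map_zero' := by
        ext q
        rw [hBrow, (hwd (s 0) 0 (by rw [hs, map_zero])).1 (s q), map_zero, AddMonoidHom.zero_apply, Int.cast_zero,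
          AddMonoidHom.zero_apply]
      map_add' := fun p p' ↦ by
        ext q
        rw [AddMonoidHom.add_apply, hBrow, hBrow, hBrow,
          (hwd (s (p + p')) (s p + s p') (by rw [hs, map_add, hs, hs])).1 (s q), map_add, AddMonoidHom.add_apply,
          Int.cast_add] }
  have hBbar : ∀ x y, Bbar (δT x) (δT y) = ((B x y : ℤ) : ZMod ℓ) := by
    intro x y
    change Brow (s (δT x)) (δT y) = _
    rw [hBrow, (hwd (s (δT x)) x (hs _)).1, (hwd (s (δT y)) y (hs _)).2]
  refine ⟨Bbar, fun t p q ↦ ?_, fun p hp ↦ ?_, fun q hq ↦ ?_⟩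
  · obtain ⟨x, rfl⟩ := hδT_surj p
    obtain ⟨y, rfl⟩ := hδT_surj q
    rw [← map_smul, ← map_smul, hBbar, hBbar, hadj]
  · obtain ⟨x, rfl⟩ := hδT_surj p
    have hdvd : ∀ y, (ℓ : ℤ) ∣ B x y := fun y ↦ by
      rw [← ZMod.intCast_zmod_eq_zero_iff_dvd, ← hBbar]
      exact hp (δT y)
    obtain ⟨z, hz⟩ := exists_eq_nsmul_of_forall_dvd B hB hdvd
    exact (hδT_ker x).mpr ⟨z, hz⟩
  · obtain ⟨y, rfl⟩ := hδT_surj q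
    have hdvd : ∀ x, (ℓ : ℤ) ∣ B x y := fun x ↦ by
      rw [← ZMod.intCast_zmod_eq_zero_iff_dvd, ← hBbar]
      exact hq (δT x)
    obtain ⟨z, hz⟩ := exists_eq_nsmul_of_forall_dvd_right B hB hdvd
    exact (hδT_ker y).mpr ⟨z, hz⟩

end TorsionPairing

end SocleCosocle

end Literature.Algebra.Module

end
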